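/-
Copyright (c) 2026 the pub-hodgecm-mathlib formalisation cell (harness21).  Prover seat hodgecm-mathlib-F0P2-p09 (g0), re-dealt to L1
`stub_firstTermThetaPairing` (director s1969∕s1970); hLiu418 = `stmt-HodgeConjecture-24832`; I4-conv (F′-fact) FILE D0a (generic brick of D0
`K2LiuKlingenFibreHaarPinned`, census `F0/P6` bus 2026-09-04T14:57Z).
-/
import Literature.MeasureTheory.RestrictedProduct.ActionInvariant   -- ★ `map_eq_rpMeasure_of_forall_apply_eq_smul`, `isFiniteMeasureOnCompacts_rpMeasure`, `rpMeasure_rpBox_eq_prod`, `rpMeasure_ne_zero`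
import Literature.MeasureTheory.RestrictedProduct.Borel             -- ★ `borelSpace`, `secondCountableTopology` of `Πʳ i, [G i, K i]`
import Literature.MeasureTheory.RestrictedProduct.CylinderSlices    -- ★ `ProdL2.isCompact_boxSet`, `ProdL2.isOpen_boxSet` (the compact open box `∏_i B_i`)
import Mathlib.MeasureTheory.Measure.Haar.Basic
import Mathlib.Topology.Algebra.RestrictedProduct.TopologicalSpace
import HarnessLib

/-!
# Crux `HLiu418`, I4-conv (F′-fact), FILE D0a — `K2LiuRestrictedProductAddHaar`: THE RESTRICTED PRODUCT OF ADDITIVE HAAR MEASURES IS AN ADDITIVE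
# HAAR MEASURE (`∏'_i (ν_i ; B_i)` on `Πʳ i, [A i, B i]` for ADDITIVE groups `A i` — the additive twin of ★ `LeftInvariant` ∕ `Haar`)

Cell `hodgecm-mathlib`, crux item hLiu418 = `stmt-HodgeConjecture-24832`; squad K2 ∕ K2Liu (re-dealt hand F0P2-p09 (g0)); LEAD F0P6-plan (g14); spec
K2Liu-p14 (g3) I4-conv census `K2/K2Liu-p14/g3/CENSUS-I4conv-FprimeFact.K2Liu-p14-g3.md` §2 FILE D0.  THEOREMS ONLY (no `def`, no instance, no notation,
no named-fact hypothesis, no `sorry`); lane `--supports stmt-HodgeConjecture-24832 --as helper` (count-neutral).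

THE POINT.  The tree's restricted-product measure `rpMeasure K ν S₀ = ∏'_i (ν_i ; K_i)` (★ `ProductMeasure`, group-free) is known to be a HAAR measure
only for MULTIPLICATIVE groups (★ `LeftInvariant.isMulLeftInvariant_rpMeasure`, ★ `Haar.isHaarMeasure_rpMeasure`: `[∀ i, Group (G i)]`, `Subgroup`s).
The Klingen fibre of ★ F5-e∕F8 (`F′_h = ∫_{Y(𝔸) × 𝔸_L} …`) and every Tate-type integral over `𝔸ⁿ` are integrals against ADDITIVE Haar measures; the pin
`(μ_Y ⊗ μ_T) ∘ E⁻¹ = μ ⊗ ∏'_{v∉T′}(ν_v ; 𝒪_v³)` of FILE D0 `K2LiuKlingenFibreHaarPinned` (binder `hmap` of ★ FILE D `K2LiuKlingenInnerSectionEuler`) needs the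
additive statements.  They follow from the tree's ACTION form ★ `ActionInvariant.map_eq_rpMeasure_of_forall_apply_eq_smul` (invariance of `rpMeasure` under
coordinatewise group ACTIONS) applied to the action of `Multiplicative (A i)` on `A i` by translations — no second copy of the gluing argument:
* §1 `isAddLeftInvariant_rpMeasure` — `(a + ·)_* ∏'_i (ν_i ; B_i) = ∏'_i (ν_i ; B_i)` for additive subgroups `B i`, left-invariant `ν i` with `ν i (B i) = 1`
  off `S₀`;
* §2 `isAddHaarMeasure_rpMeasure` — for second countable locally compact additive groups `A i`, COMPACT OPEN subgroups `B i` and additive Haar measures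
  `ν i` with `ν i (B i) = 1` (all `i`; `S₀ = ∅`, the case of ★ FILE D), `∏'_i (ν_i ; B_i)` is an additive Haar measure on `Πʳ i, [A i, B i]`, σ-finite and
  non-zero (Mathlib `isAddHaarMeasure_of_isCompact_nonempty_interior` at the compact open box `∏_i B_i`, whose mass is `1` by ★ `rpMeasure_rpBox_eq_prod`).
[CasselsFrohlichANT1967, Ch. XV (Tate) §3.3 Thm. 3.3.1 and pp. 352–353], [Guichardet1972, App. D §D.3], [WeilBNT1967, Ch. IV §1 (Haar measure of `k_𝔸`)].
HONEST LABEL.  Count-neutral helper: `HC_CM` is proved only modulo the 7 printed citations (2 remaining named inputs: hLiu418 = `stmt-HodgeConjecture-24832`,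
h413 = `stmt-HodgeConjecture-24833`) until rung 0 closes.

## Mathlib ∕ tree search
Tree ★: `ActionInvariant.{map_eq_rpMeasure_of_forall_apply_eq_smul, isFiniteMeasureOnCompacts_rpMeasure, rpMeasure_rpBox_eq_prod, rpMeasure_ne_zero}`,
`Borel.{borelSpace, secondCountableTopology}`, `ProductMeasureRestrict.sigmaFinite_rpMeasure`, `ProductMeasure.{rpBox, measurableSet_rpBox}`;
Mathlib: `RestrictedProduct` additive-group ∕ topological-group instances (`to_additive`), `isAddHaarMeasure_of_isCompact_nonempty_interior`,
`RestrictedProduct.isOpen_forall_mem`, `Multiplicative.mulAction`.  Dedup: `rg "isAddLeftInvariant_rpMeasure|isAddHaarMeasure_rpMeasure"` — none (the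
additive Haar-slice file ★ `CylinderSlices` starts FROM a Haar measure on `Πʳ` and never meets `rpMeasure`).

## References
* [CasselsFrohlichANT1967] J. W. S. Cassels, A. Fröhlich (eds.), *Algebraic Number Theory* (1967), Ch. XV (Tate) §3.3.
* [Guichardet1972] A. Guichardet, *Symmetric Hilbert Spaces and Related Topics*, LNM 261 (1972), App. D §D.3.
* [WeilBNT1967] A. Weil, *Basic Number Theory* (1967), Ch. IV §1.
-/

set_option autoImplicit false
set_option linter.dupNamespace false -- the mandated namespace repeats `HodgeConjecture.HodgeConjecture`

noncomputable section

open scoped RestrictedProduct ENNReal NNReal Topology Pointwise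
open MeasureTheory Measure Filter Set

namespace Summit.HodgeConjecture.HodgeConjecture.Cruxes.HLiu418.K2LiuRestrictedProductAddHaar

open Literature.MeasureTheory.RestrictedProduct

universe u v

variable {ι : Type u} {A : ι → Type v} [∀ i, AddCommGroup (A i)] [∀ i, MeasurableSpace (A i)]
  (B : ∀ i, AddSubgroup (A i)) (ν : ∀ i, Measure (A i))

/-! ## §1 Additive left-invariance of `∏'_i (ν_i ; B_i)` -/

section Invariance

variable [∀ i, MeasurableAdd (A i)] [Countable ι] [∀ i, SigmaFinite (ν i)] [∀ i, (ν i).IsAddLeftInvariant]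

/-- **`(a + ·)_* ∏'_i (ν_i ; B_i) = ∏'_i (ν_i ; B_i)`** for every `a ∈ Πʳ i, [A i, B i]`: additive left-invariance of the restricted product of
left-invariant measures (`B i` measurable additive subgroups, `ν i (B i) = 1` off `S₀`) — ★ `map_eq_rpMeasure_of_forall_apply_eq_smul` for the translation
action of `Multiplicative (A i)` on `A i`. [cite: CasselsFrohlichANT1967, Ch. XV (Tate) §3.3] -/
theorem map_add_left_rpMeasure (hBm : ∀ i, MeasurableSet (B i : Set (A i))) {S₀ : Finset ι}
    (hB1 : ∀ i, i ∉ S₀ → ν i (B i : Set (A i)) = 1) (a : Πʳ i, [A i, B i]) :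
    (rpMeasure (fun i => (B i : Set (A i))) ν S₀).map (a + ·) = rpMeasure (fun i => (B i : Set (A i))) ν S₀ := by
  -- the translation action of `Multiplicative (A i)` on `A i`: `g • x = toAdd g + x`
  haveI : ∀ i, MeasurableConstSMul (Multiplicative (A i)) (A i) := fun i =>
    ⟨fun c => measurable_const_add (Multiplicative.toAdd c)⟩
  haveI : ∀ i, SMulInvariantMeasure (Multiplicative (A i)) (A i) (ν i) := fun i =>
    ⟨fun c s hs => measure_preimage_add (ν i) (Multiplicative.toAdd c) s⟩
  have hBC : ∀ i, ∀ k ∈ (B i).toSubgroup, k • (B i : Set (A i)) = (B i : Set (A i)) := by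
    intro i k hk
    ext x
    constructor
    · rintro ⟨y, hy, rfl⟩
      exact (B i).add_mem hk hy
    · intro hx
      exact ⟨Multiplicative.toAdd k⁻¹ + x, (B i).add_mem ((B i).neg_mem hk) hx, by
        show Multiplicative.toAdd k + (Multiplicative.toAdd k⁻¹ + x) = x
        rw [toAdd_inv, add_neg_cancel_left]⟩
  exact map_eq_rpMeasure_of_forall_apply_eq_smul (fun i => (B i : Set (A i))) ν (fun i => (B i).toSubgroup) hBm hBC hB1
    (fun i => Multiplicative.ofAdd (a i)) a.2 (a + ·) (fun z i => rfl)

/-- **The restricted product of left-invariant measures on additive groups is ADDITIVELY LEFT-INVARIANT.** [cite: CasselsFrohlichANT1967, Ch. XV (Tate) §3.3] -/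
theorem isAddLeftInvariant_rpMeasure (hBm : ∀ i, MeasurableSet (B i : Set (A i))) {S₀ : Finset ι}
    (hB1 : ∀ i, i ∉ S₀ → ν i (B i : Set (A i)) = 1) :
    (rpMeasure (fun i => (B i : Set (A i))) ν S₀).IsAddLeftInvariant :=
  ⟨fun a => map_add_left_rpMeasure B ν hBm hB1 a⟩

end Invariance

/-! ## §2 The restricted product of additive Haar measures along compact open subgroups is an additive Haar measure -/

section Haar

variable [∀ i, TopologicalSpace (A i)] [∀ i, IsTopologicalAddGroup (A i)] [∀ i, SecondCountableTopology (A i)] [∀ i, BorelSpace (A i)]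
  [Countable ι] [hBo : Fact (∀ i, IsOpen (B i : Set (A i)))] [∀ i, SigmaFinite (ν i)] [∀ i, (ν i).IsAddHaarMeasure]

omit [∀ i, MeasurableSpace (A i)] [∀ i, IsTopologicalAddGroup (A i)] [∀ i, SecondCountableTopology (A i)] [∀ i, BorelSpace (A i)] [Countable ι]
  [∀ i, SigmaFinite (ν i)] [∀ i, (ν i).IsAddHaarMeasure] in
/-- the box `A_∅ = ∏_i B_i` is compact and open in `Πʳ i, [A i, B i]` when every `B i` is compact open (★ `ProdL2.isCompact_boxSet` ∕ `isOpen_boxSet`).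
[cite: CasselsFrohlichANT1967, Ch. XV (Tate) §3.3] -/
theorem isCompact_isOpen_rpBox_empty (hBc : ∀ i, IsCompact (B i : Set (A i))) :
    IsCompact (rpBox (fun i => (B i : Set (A i))) ∅) ∧ IsOpen (rpBox (fun i => (B i : Set (A i))) ∅) := by
  have hset : rpBox (fun i => (B i : Set (A i))) ∅ = ProdL2.boxSet B := by
    ext x
    simp only [rpBox, Finset.notMem_empty, not_false_eq_true, forall_const, mem_setOf_eq, ProdL2.mem_boxSet_iff]
  haveI : ∀ i, CompactSpace (B i) := fun i => isCompact_iff_compactSpace.mp (hBc i)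
  rw [hset]
  exact ⟨ProdL2.isCompact_boxSet, ProdL2.isOpen_boxSet⟩

/-- **THE RESTRICTED PRODUCT OF ADDITIVE HAAR MEASURES IS AN ADDITIVE HAAR MEASURE.**  `A i` second countable additive topological groups (countably many),
`B i ≤ A i` COMPACT OPEN subgroups, `ν i` additive Haar measures with `ν i (B i) = 1`; THEN `∏'_i (ν_i ; B_i) = rpMeasure (fun i => ↑(B i)) ν ∅` is an additive
Haar measure on `Πʳ i, [A i, B i]`, σ-finite, and gives the box `∏_i B_i` mass `1` (§1 + Mathlib `isAddHaarMeasure_of_isCompact_nonempty_interior` at the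
compact open box, ★ `rpMeasure_rpBox_eq_prod`, ★ `sigmaFinite_rpMeasure`). [cite: CasselsFrohlichANT1967, Ch. XV (Tate) §3.3 Thm. 3.3.1] [cite: WeilBNT1967, Ch. IV §1] -/
theorem isAddHaarMeasure_rpMeasure (hBc : ∀ i, IsCompact (B i : Set (A i))) (hB1 : ∀ i, ν i (B i : Set (A i)) = 1) :
    (rpMeasure (fun i => (B i : Set (A i))) ν ∅).IsAddHaarMeasure ∧ SigmaFinite (rpMeasure (fun i => (B i : Set (A i))) ν ∅) ∧
      rpMeasure (fun i => (B i : Set (A i))) ν ∅ (rpBox (fun i => (B i : Set (A i))) ∅) = 1 := by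
  have hBm : ∀ i, MeasurableSet (B i : Set (A i)) := fun i => (hBo.out i).measurableSet
  haveI : BorelSpace (Πʳ i, [A i, B i]) := borelSpace (fun i => (B i : Set (A i))) hBm
  haveI := isAddLeftInvariant_rpMeasure B ν hBm (S₀ := ∅) (fun i _ => hB1 i)
  have hKne : ∀ i, ((B i : Set (A i))).Nonempty := fun i => ⟨0, (B i).zero_mem⟩
  have h1 : rpMeasure (fun i => (B i : Set (A i))) ν ∅ (rpBox (fun i => (B i : Set (A i))) ∅) = 1 := by
    rw [rpMeasure_rpBox_eq_prod (fun i => (B i : Set (A i))) ν hKne hBm (S₀ := ∅) (fun i _ => hB1 i) (Finset.Subset.refl ∅),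
      Finset.prod_empty]
  obtain ⟨hc, ho⟩ := isCompact_isOpen_rpBox_empty B hBc
  have hne : (interior (rpBox (fun i => (B i : Set (A i))) ∅)).Nonempty := by
    rw [ho.interior_eq]
    exact ⟨0, fun i _ => (B i).zero_mem⟩
  exact ⟨isAddHaarMeasure_of_isCompact_nonempty_interior _ _ hc hne (by rw [h1]; exact one_ne_zero) (by rw [h1]; exact ENNReal.one_ne_top),
    sigmaFinite_rpMeasure _ ν hBm (S₀ := ∅) (fun i _ => hB1 i), h1⟩

omit [∀ i, IsTopologicalAddGroup (A i)] [∀ i, SecondCountableTopology (A i)] [∀ i, BorelSpace (A i)] [Countable ι] [∀ i, SigmaFinite (ν i)] in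
/-- the same with the local Haar measures RESCALED to `ν i (B i) = 1`: for arbitrary additive Haar measures `ν i` the family `(ν i (B i))⁻¹ • ν i` qualifies
(`B i` compact open ⇒ `0 < ν i (B i) < ∞`). [cite: CasselsFrohlichANT1967, Ch. XV (Tate) §3.3] -/
theorem isAddHaarMeasure_smul_inv (hBc : ∀ i, IsCompact (B i : Set (A i))) (i : ι) :
    ((ν i (B i : Set (A i)))⁻¹ • ν i).IsAddHaarMeasure ∧ ((ν i (B i : Set (A i)))⁻¹ • ν i) (B i : Set (A i)) = 1 := by
  have hpos : ν i (B i : Set (A i)) ≠ 0 := ((hBo.out i).measure_pos (ν i) ⟨0, (B i).zero_mem⟩).ne'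
  have htop : ν i (B i : Set (A i)) ≠ ∞ := (hBc i).measure_lt_top.ne
  refine ⟨IsAddHaarMeasure.smul (ν i) (ENNReal.inv_ne_zero.mpr htop) (ENNReal.inv_ne_top.mpr hpos), ?_⟩
  rw [Measure.smul_apply, smul_eq_mul, ENNReal.inv_mul_cancel hpos htop]

end Haar

end Summit.HodgeConjecture.HodgeConjecture.Cruxes.HLiu418.K2LiuRestrictedProductAddHaar

end
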